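import Summits.ValiantsHypothesis.ValiantsHypothesis.Theorems.BarrierLeverAnchoredDoorHitsLowerPairsStarCofactorPrelims
import Summits.ValiantsHypothesis.ValiantsHypothesis.Theorems.BarrierLeverAnchoredDoorHitsLowerPairsStarPivot
import Mathlib.LinearAlgebra.Matrix.Adjugate

/-!
# Route BarrierLever — support item `AnchoredDoorHitsLowerPairs` (stmt-ValiantsHypothesis-22510), line `anchored_peeling`:
# THE VERTEX–FACET COFACTOR CERTIFICATE FOR THE STAR-FOREST MATRIX (val-np-p1 g31)

A certificate for the door slot `Stmt.conjStarLower` that lives ONE LAYER INSIDE the evaluation face (memo HOME/val-np-p1/g31/MEMO-trop-valnp1-g31.md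
§9b): if the row family contains the vertex `{b}` exactly at index `i₀` and the column `T = w j₀ ≠ ∅` occurs exactly at `j₀` and is ⊆-MAXIMAL among
the columns, then for EVERY `θ` the `(j₀, i₀)` entry of the ADJUGATE of the pure evaluation matrix `E = (∏_{b' ∈ u i} Σ_{e ∈ w j} θ_{b'e})` (the
cofactor deleting the vertex row and the facet column) is the coefficient of degree `(h+1)·Σ|u i| − (h+1−|T|)` of the star-forest determinant along
the family of `…StarCofactorPrelims` (`coeff_det_famMat`; gap lemma + `Matrix.det_apply'` + `Matrix.adjugate_apply`). Hence
`starDet_ne_zero_of_cofactor`: a nonzero vertex–facet cofactor of SOME evaluation matrix gives a nonsingular star-forest block — no lower-set or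
injectivity hypothesis. CENSUS (memo §9b/§11; kit j334714, j334780): EVERY corank-1 lower pair computed (718 orientations: all ≤ 5+5 and 197 random
6–7-vertex pairs) has such a certificate, and so does the 7+7 residual pair of the pivot/evaluation mechanisms; at corank 0 the evaluation face
itself applies (`…StarFaces`). This file does NOT prove `Stmt.conjStarLower`; nothing here bears on crux 14610 or on `VP ≠ VNP`.
-/

set_option linter.dupNamespace false

namespace Summit.ValiantsHypothesis.ValiantsHypothesis.Theorems.BarrierLever.AnchoredPeeling

open Finset Polynomial

noncomputable section

namespace StarDoor

variable {h : ℕ}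

/-! ## 3. The coefficient of the determinant along the family is the vertex–facet cofactor -/

section Assembly

variable {r : ℕ} (u w : Fin r → Finset (Fin h)) (θ : Fin h → Fin h → ℂ) (b : Fin h) (T : Finset (Fin h)) (i₀ j₀ : Fin r)

/-- For a permutation `σ`, the product of the updated matrix `E.updateRow i₀ e_{j₀}` along `σ` is `[σ j₀ = i₀] · ∏_{i ≠ j₀} E (σ i) i`. -/
theorem prod_updateRow_single (E : Matrix (Fin r) (Fin r) ℂ) (σ : Equiv.Perm (Fin r)) :
    ∏ i, (E.updateRow i₀ (Pi.single j₀ 1)) (σ i) i =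
      if σ j₀ = i₀ then ∏ i ∈ Finset.univ.erase j₀, E (σ i) i else 0 := by
  classical
  by_cases hσ : σ j₀ = i₀
  · rw [if_pos hσ, ← Finset.mul_prod_erase Finset.univ _ (Finset.mem_univ j₀)]
    rw [Matrix.updateRow_apply, if_pos hσ, Pi.single_eq_same, one_mul]
    refine Finset.prod_congr rfl fun i hi => ?_
    have hij : i ≠ j₀ := Finset.ne_of_mem_erase hi
    have hne : σ i ≠ i₀ := fun h' => hij (σ.injective (h'.trans hσ.symm))
    rw [Matrix.updateRow_apply, if_neg hne]
  · rw [if_neg hσ]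
    apply Finset.prod_eq_zero (Finset.mem_univ (σ.symm i₀))
    rw [Matrix.updateRow_apply, if_pos (σ.apply_symm_apply i₀)]
    have hne : σ.symm i₀ ≠ j₀ := fun h' => hσ (by rw [← h', σ.apply_symm_apply])
    simp [hne]

/-- **The coefficient identity.** With `D = Σ_i |u i|`, `a = h + 1`: the coefficient of degree `a·D − (a − |T|)` of the star-forest determinant along the family equals the
`(j₀, i₀)` adjugate entry of the evaluation matrix (the cofactor deleting the vertex row `i₀` and the facet column `j₀`). -/
theorem coeff_det_famMat (hu0 : ∀ i, u i = {b} ↔ i = i₀) (hw0 : ∀ j, w j = T ↔ j = j₀) (hT : T.Nonempty)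
    (hmax : ∀ j, T ⊆ w j → w j = T) :
    (Matrix.of fun i j : Fin r => starEntry (fun b' e => (X : Polynomial ℂ) ^ (h + 1) * C (θ b' e)) (fun x e => if x = b ∧ e ∈ T then (X : Polynomial ℂ) else 0) (u i) (w j)).det.coeff ((h + 1) * (∑ i, (u i).card) - ((h + 1) - T.card)) = (Matrix.of fun i j : Fin r => ∏ b' ∈ u i, ∑ e ∈ w j, θ b' e).adjugate j₀ i₀ := by
  classical
  have hTh : T.card ≤ h := by simpa using Finset.card_le_univ T
  have hTpos : 1 ≤ T.card := Finset.card_pos.mpr hT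
  set a := h + 1 with ha
  set gap := a - T.card with hgap
  have hgap1 : 1 ≤ gap := by omega
  have hui₀ : u i₀ = {b} := (hu0 i₀).mpr rfl
  have hD : 1 ≤ ∑ i, (u i).card :=
    le_trans (by rw [hui₀, Finset.card_singleton]) (Finset.single_le_sum (fun i _ => Nat.zero_le _) (Finset.mem_univ i₀))
  rw [Matrix.det_apply', Matrix.adjugate_apply, Matrix.det_apply', Polynomial.finsetSum_coeff]
  refine Finset.sum_congr rfl fun σ _ => ?_
  -- `ε σ` is `± 1`
  have hsign : ∀ (p : Polynomial ℂ) (n : ℕ), ((Equiv.Perm.sign σ : ℤ) * p : Polynomial ℂ).coeff n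
      = (Equiv.Perm.sign σ : ℤ) * p.coeff n := by
    intro p n
    rcases Int.units_eq_one_or (Equiv.Perm.sign σ) with h1 | h1 <;> simp [h1]
  rw [hsign, prod_updateRow_single]
  congr 1
  -- apply the gap lemma to the product along `σ`
  let f : Fin r → Polynomial ℂ := fun i => (Matrix.of fun i j : Fin r => starEntry (fun b' e => (X : Polynomial ℂ) ^ (h + 1) * C (θ b' e)) (fun x e => if x = b ∧ e ∈ T then (X : Polynomial ℂ) else 0) (u i) (w j)) (σ i) i
  let top : Fin r → ℕ := fun i => a * (u (σ i)).card
  have hf : ∀ i ∈ (Finset.univ : Finset (Fin r)), ∀ e, (f i).coeff e ≠ 0 → e = top i ∨ e + gap ≤ top i := by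
    intro i _ e he
    exact family_entry_shape θ b T (u (σ i)) (w i) e he
  obtain ⟨_, htop, hdrop⟩ := coeff_prod_gap Finset.univ f top gap hgap1 hf
  have htot : ∑ i, top i = a * ∑ i, (u i).card := by
    simp only [top]
    rw [← Finset.mul_sum, Equiv.sum_comp σ (fun i => (u i).card)]
  have hgaptot : gap ≤ ∑ i, top i := by
    rw [htot]; exact le_trans (by omega : gap ≤ a * 1) (Nat.mul_le_mul_left _ hD)
  have hdrop' := hdrop hgaptot
  rw [htot] at hdrop'
  show (∏ i, f i).coeff (a * ∑ i, (u i).card - gap) = _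
  rw [hdrop']
  -- evaluate the drop coefficients and the leading coefficients
  have hlead : ∀ i, (f i).coeff (top i) = (Matrix.of fun i j : Fin r => ∏ b' ∈ u i, ∑ e ∈ w j, θ b' e) (σ i) i := fun i => family_entry_top θ b T (u (σ i)) (w i)
  have hdropval : ∀ i, (if gap ≤ top i then (f i).coeff (top i - gap) else 0) = if σ i = i₀ ∧ i = j₀ then (1 : ℂ) else 0 := by
    intro i
    simp only [top]
    by_cases hA : (u (σ i)).Nonempty
    · have hcard : 1 ≤ (u (σ i)).card := Finset.card_pos.mpr hA
      rw [if_pos (le_trans (by omega : gap ≤ a * 1) (Nat.mul_le_mul_left _ hcard))]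
      have heq : a * (u (σ i)).card - gap = a * ((u (σ i)).card - 1) + T.card := by
        have hk : a ≤ a * (u (σ i)).card := Nat.le_mul_of_pos_right _ hcard
        rw [hgap, Nat.mul_sub, mul_one]; omega
      rw [heq]
      show (starEntry (fun b' e => (X : Polynomial ℂ) ^ (h + 1) * C (θ b' e)) (fun x e => if x = b ∧ e ∈ T then (X : Polynomial ℂ) else 0) (u (σ i)) (w i)).coeff _ = _
      rw [family_entry_drop θ b T (u (σ i)) (w i) hA hT (hmax i)]
      simp only [hu0, hw0]
    · have h0 : (u (σ i)).card = 0 := by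
        rw [Finset.card_eq_zero]; exact Finset.not_nonempty_iff_eq_empty.mp hA
      rw [h0, mul_zero, if_neg (by omega)]
      rw [if_neg]
      rintro ⟨hσi, -⟩
      apply hA
      rw [hσi, hui₀]; exact Finset.singleton_nonempty b
  simp only [hdropval, hlead, ite_mul, one_mul, zero_mul]
  rw [Finset.sum_ite, Finset.sum_const_zero, add_zero]
  by_cases hσ : σ j₀ = i₀
  · rw [if_pos hσ]
    have hfilter : Finset.univ.filter (fun i => σ i = i₀ ∧ i = j₀) = {j₀} := by
      ext i
      simp only [Finset.mem_filter, Finset.mem_univ, true_and, Finset.mem_singleton]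
      constructor
      · exact fun h' => h'.2
      · intro h'; subst h'; exact ⟨hσ, rfl⟩
    rw [hfilter, Finset.sum_singleton]
  · rw [if_neg hσ]
    have hfilter : Finset.univ.filter (fun i => σ i = i₀ ∧ i = j₀) = ∅ := by
      ext i
      simp only [Finset.mem_filter, Finset.mem_univ, true_and, Finset.notMem_empty, iff_false]
      rintro ⟨h1, h2⟩; subst h2; exact hσ h1
    rw [hfilter, Finset.sum_empty]

end Assembly

/-! ## 4. The certificate -/

/-- **VERTEX–FACET COFACTOR CERTIFICATE.** Let `u`, `w` be families of `r` faces, `u i₀ = {b}` the only occurrence of the vertex `{b}` among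
the rows, `w j₀ = T ≠ ∅` the only occurrence of `T` among the columns, and `T` ⊆-maximal among the columns. If for some `θ` the cofactor of
the pure evaluation matrix `(∏_{b' ∈ u i} Σ_{e ∈ w j} θ_{b'e})` complementary to row `i₀` and column `j₀` is nonzero, then some star-forest block
of `(u, w)` is nonsingular. -/
theorem starDet_ne_zero_of_cofactor {r : ℕ} (u w : Fin r → Finset (Fin h)) (b : Fin h) (T : Finset (Fin h)) (i₀ j₀ : Fin r)
    (hu0 : ∀ i, u i = {b} ↔ i = i₀) (hw0 : ∀ j, w j = T ↔ j = j₀) (hT : T.Nonempty) (hmax : ∀ j, T ⊆ w j → w j = T)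
    (hcof : ∃ θ : Fin h → Fin h → ℂ, (Matrix.of fun i j : Fin r => ∏ b' ∈ u i, ∑ e ∈ w j, θ b' e).adjugate j₀ i₀ ≠ 0) :
    ∃ g d : Fin h → Fin h → ℂ, (Matrix.of fun i j : Fin r => starEntry g d (u i) (w j)).det ≠ 0 := by
  classical
  obtain ⟨θ, hθ⟩ := hcof
  have hP : (Matrix.of fun i j : Fin r => starEntry (fun b' e => (X : Polynomial ℂ) ^ (h + 1) * C (θ b' e)) (fun x e => if x = b ∧ e ∈ T then (X : Polynomial ℂ) else 0) (u i) (w j)).det ≠ 0 := by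
    intro h0
    apply hθ
    have := coeff_det_famMat u w θ b T i₀ j₀ hu0 hw0 hT hmax
    rw [h0, Polynomial.coeff_zero] at this
    exact this.symm
  -- a nonzero complex polynomial has a non-root
  have hex : ∃ t : ℂ, ¬ (Matrix.of fun i j : Fin r => starEntry (fun b' e => (X : Polynomial ℂ) ^ (h + 1) * C (θ b' e)) (fun x e => if x = b ∧ e ∈ T then (X : Polynomial ℂ) else 0) (u i) (w j)).det.IsRoot t := by
    by_contra hall
    push Not at hall
    apply hP
    apply Polynomial.eq_zero_of_infinite_isRoot
    have huniv : {x : ℂ | (Matrix.of fun i j : Fin r => starEntry (fun b' e => (X : Polynomial ℂ) ^ (h + 1) * C (θ b' e)) (fun x e => if x = b ∧ e ∈ T then (X : Polynomial ℂ) else 0) (u i) (w j)).det.IsRoot x} = Set.univ := Set.eq_univ_of_forall fun x => hall x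
    rw [huniv]
    exact Set.infinite_univ
  obtain ⟨t, ht⟩ := hex
  refine ⟨fun b' e => Polynomial.eval t ((fun b' e => (X : Polynomial ℂ) ^ (h + 1) * C (θ b' e)) b' e), fun x e => Polynomial.eval t ((fun x e => if x = b ∧ e ∈ T then (X : Polynomial ℂ) else 0) x e), ?_⟩
  rw [Polynomial.IsRoot] at ht
  intro h0
  apply ht
  rw [← Polynomial.coe_evalRingHom, RingHom.map_det, RingHom.mapMatrix_apply]
  rw [← h0]
  congr 1
  ext i j
  simp only [Matrix.map_apply, Matrix.of_apply]
  rw [map_starEntry]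
  rfl

end StarDoor

end

end Summit.ValiantsHypothesis.ValiantsHypothesis.Theorems.BarrierLever.AnchoredPeeling
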